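import Summits.ResolutionOfSingularities.ResolutionOfSingularities.Theorems.FrobeniusClosingSteerCurveEscapeSeed
import Mathlib.RingTheory.LocalRing.LocalSubring
import HarnessLib

/-!
# Crux `Steer` (stmt-ResolutionOfSingularities-16345), chain W4.1, σ-residual SUPPORT: **CurveEscape, residue
# tower** (helper γ, part 4; Theses-free, def-free)

OURS (campaign `res-hironaka`, rung L ★L-G4, slot W4.1; a statement about the route's own objects — sequences of
quadratic transforms of local rings along a valuation ring (`Resolution.IsQuadraticTransformAlong`); it replaces the
role of no printed item and is NOT a statement of the manuscript under review [claim: Hironaka2017, status: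
under-review]; AI review is weaker than expert review). res-L0-w41-plan-1 RULING 14 (14e) (HOME/STATUS
2026-08-27T08:16:00Z): GO for the γ-bridge `curveEscape_of_finite_integralClosure` (part 5,
`FrobeniusClosingSteerCurveEscapeResidue.lean`); seat res-type-038. This part builds the COMMON LOCAL RING of the
followed curve.

## Setting and content

`O ⊆ K` a valuation ring, `R 0 → R 1 → ⋯` quadratic transforms along `O` (`R (i+1) = (R i)[𝔪_i/x_i]_{𝔪_O ∩ …}`),
primes `P i ⊂ R i` with `P i ≠ 𝔪_i` and `P (i+1) ∩ R i = P i` (the strict transforms of ONE curve hosting every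
centre).

* §8 `subringDominates_of_dimensionLEOne_quotient` (KEY REMARK 2′, one step `R → R'`): if the residue ring `R ⧸ P`
  has dimension `≤ 1` (every non-zero prime maximal) and the curve is still followed after the step
  (`P' ≠ 𝔪_{R'}`), then `O` dominates `R` AUTOMATICALLY — the centre `𝔮 = 𝔪_{R'} ∩ R` of `O` on `R` contains `P`,
  is not maximal as soon as some non-unit of `R` is a unit of `O`, hence equals `P`; then every `s ∈ R ∖ P` is a
  unit of `R'` and the fraction decomposition `r''·s = t` (part 3) forces `𝔪_{R'} ≤ P'`.  (Part 3's KEY REMARK 2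
  is the special case `R ⧸ P` a discrete valuation ring.)
* §9 `exists_le_ofPrime_comap_eq`: with `B := (R 0)_{P 0} ⊆ K` (Mathlib `LocalSubring.ofPrime`), EVERY `R i`
  lies in `B` and `𝔪_B ∩ R i = P i` — i.e. `(R i)_{P i} = B` for all `i` (the blow-up is an isomorphism off the
  exceptional divisor, and `x_i ∉ P (i+1)`).  Consequences `inv_mem_ofPrime_of_not_mem` (elements of `R i ∖ P i`
  are units of `B`) and `mem_maximalIdeal_ofPrime_iff`.

Def-free, sorry-free. Part 5 reads the residue rings `R i ⧸ P i` inside the residue field of `B`.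
-/

noncomputable section

set_option linter.dupNamespace false

namespace Summit.ResolutionOfSingularities.ResolutionOfSingularities.Theorems.SwitchingDichotomy.CurveEscape

open IsLocalRing Literature.AlgebraicGeometry.Resolution

universe u

variable {K : Type u} [Field K]

/-! ## §8 KEY REMARK 2′: domination of the base is automatic for a one-dimensional residue ring -/

section OneStepDim

variable {O : ValuationSubring K} {R R' : Subring K} [IsLocalRing R] [IsLocalRing R']

/-- **KEY REMARK 2′ — domination is automatic.** One quadratic transform `R → R'` along `O`, primes
`P' ∩ R = P ≠ 𝔪_R` with `P' ≠ 𝔪_{R'}`; if every non-zero prime of the domain `R ⧸ P` is maximal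
(`Ring.DimensionLEOne`, e.g. `R ⧸ P` Noetherian of dimension one), then `O` dominates `R`. Proof: the centre
`𝔮 := 𝔪_{R'} ∩ R ⊇ P` is a prime of `R`; a non-unit `y` of `R` invertible in `O` is a unit of `R'`, so `y ∉ 𝔮`
and `𝔮` is not maximal, whence `𝔮/P = 0` in `R ⧸ P`, `𝔮 = P`; then every `s ∈ R ∖ P` is a unit of `R'`, and for
`r'' ∈ 𝔪_{R'}` with `r''·s = t` (`exists_mul_inclusion_eq`) the case `t ∉ P` would make `r''` a unit — so
`𝔪_{R'} ≤ P'`, contradicting `P' ≠ 𝔪_{R'}`. OURS. [folklore] -/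
theorem subringDominates_of_dimensionLEOne_quotient (h : IsQuadraticTransformAlong O R R') {x : R}
    (hx0 : x ≠ 0) (hR' : R' = locAtCentre (blowupRing R (x : K)) O) {P : Ideal R} {P' : Ideal R'}
    [P.IsPrime] [P'.IsPrime] (hP : P ≠ maximalIdeal R) (hP' : P' ≠ maximalIdeal R')
    (hc : P'.comap (Subring.inclusion h.le) = P) (hdim : Ring.DimensionLEOne (R ⧸ P)) :
    SubringDominates R O.toSubring := by
  classical
  refine ⟨h.source_le, fun y hy hyO => ?_⟩
  by_contra hyR
  have hy0 : y ≠ 0 := by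
    rintro rfl
    exact hyR (by rw [inv_zero]; exact R.zero_mem)
  have hy𝔪 : (⟨y, hy⟩ : R) ∈ maximalIdeal R := (mem_maximalIdeal_iff_inv_not_mem _).mpr (Or.inr hyR)
  -- the centre `𝔮 = 𝔪_{R'} ∩ R`
  set 𝔮 : Ideal R := (maximalIdeal R').comap (Subring.inclusion h.le) with h𝔮def
  haveI h𝔮p : 𝔮.IsPrime := Ideal.IsPrime.comap _
  have hyunit : IsUnit (Subring.inclusion h.le ⟨y, hy⟩) := by
    rw [isUnit_subring_iff_inv_mem]
    exact ⟨hy0, h.dominated.2 y (h.le hy) hyO⟩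
  have hy𝔮 : (⟨y, hy⟩ : R) ∉ 𝔮 := fun hmem =>
    (IsLocalRing.mem_maximalIdeal _).mp (Ideal.mem_comap.mp hmem) hyunit
  have hP𝔮 : P ≤ 𝔮 := by
    rw [← hc]
    exact Ideal.comap_mono (IsLocalRing.le_maximalIdeal (Ideal.IsPrime.ne_top ‹_›))
  -- `𝔮 = P`: its image in the one-dimensional domain `R ⧸ P` is a non-maximal prime, hence `⊥`
  have h𝔮P : 𝔮 = P := by
    refine le_antisymm ?_ hP𝔮
    have hker : RingHom.ker (Ideal.Quotient.mk P) ≤ 𝔮 := by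
      rw [Ideal.mk_ker]
      exact hP𝔮
    haveI h𝔮' : (𝔮.map (Ideal.Quotient.mk P)).IsPrime :=
      Ideal.map_isPrime_of_surjective Ideal.Quotient.mk_surjective hker
    by_cases hbot : 𝔮.map (Ideal.Quotient.mk P) = ⊥
    · intro z hz
      have h1 : Ideal.Quotient.mk P z ∈ 𝔮.map (Ideal.Quotient.mk P) := Ideal.mem_map_of_mem _ hz
      rw [hbot, Ideal.mem_bot, Ideal.Quotient.eq_zero_iff_mem] at h1
      exact h1
    · exfalso
      haveI := hdim
      have hmax : (𝔮.map (Ideal.Quotient.mk P)).IsMaximal := Ring.DimensionLEOne.maximalOfPrime hbot h𝔮'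
      have h2 : (𝔮.map (Ideal.Quotient.mk P)).comap (Ideal.Quotient.mk P) = 𝔮 := by
        rw [Ideal.comap_map_of_surjective _ Ideal.Quotient.mk_surjective]
        refine sup_eq_left.mpr ?_
        rw [← RingHom.ker_eq_comap_bot]
        exact hker
      have h3 : 𝔮.IsMaximal := by
        rw [← h2]
        exact Ideal.comap_isMaximal_of_surjective _ Ideal.Quotient.mk_surjective
      exact hy𝔮 ((IsLocalRing.eq_maximalIdeal h3) ▸ hy𝔪)
  -- every `s ∈ R ∖ P` is a unit of `R'`
  have hunit : ∀ s : R, s ∉ P → IsUnit (Subring.inclusion h.le s) := by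
    intro s hs
    by_contra hns
    have h1 : s ∈ 𝔮 := Ideal.mem_comap.mpr ((IsLocalRing.mem_maximalIdeal _).mpr hns)
    rw [h𝔮P] at h1
    exact hs h1
  -- hence `𝔪_{R'} ≤ P'`
  apply hP'
  refine le_antisymm (IsLocalRing.le_maximalIdeal (Ideal.IsPrime.ne_top ‹_›)) fun r'' hr'' => ?_
  obtain ⟨s, t, hsP, hst⟩ := exists_mul_inclusion_eq h hx0 hR' hP hc r''
  by_cases htP : t ∈ P
  · have h1 : r'' * Subring.inclusion h.le s ∈ P' := by rw [hst, ← Ideal.mem_comap, hc]; exact htP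
    rcases Ideal.IsPrime.mem_or_mem ‹_› h1 with h2 | h2
    · exact h2
    · rw [← Ideal.mem_comap, hc] at h2
      exact absurd h2 hsP
  · exfalso
    have h1 : IsUnit (r'' * Subring.inclusion h.le s) := by rw [hst]; exact hunit t htP
    exact (IsLocalRing.mem_maximalIdeal _).mp hr'' (isUnit_of_mul_isUnit_left h1)

end OneStepDim

/-! ## §9 The common local ring `B = (R 0)_{P 0} ⊆ K` of the followed curve -/

section Tower

variable {O : ValuationSubring K} {R : ℕ → Subring K}
  (hq : ∀ i, IsQuadraticTransformAlong O (R i) (R (i + 1))) [∀ i, IsLocalRing (R i)]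
  {P : (i : ℕ) → Ideal (R i)} [∀ i, (P i).IsPrime]
  (hP𝔪 : ∀ i, P i ≠ maximalIdeal (R i))
  (hc : ∀ i, (P (i + 1)).comap (Subring.inclusion (hq i).le) = P i)
  {x : (i : ℕ) → R i} (hx0 : ∀ i, x i ≠ 0)
  (hR : ∀ i, R (i + 1) = locAtCentre (blowupRing (R i) (x i : K)) O)

include hP𝔪 hc hx0 hR in
/-- The exceptional parameter is prime to the followed curve: `x i ∉ P i`. OURS bookkeeping. [folklore] -/
theorem param_not_mem (i : ℕ) : x i ∉ P i := by
  intro hmem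
  have h1 : Subring.inclusion (hq i).le (x i) ∈ P (i + 1) := by rw [← Ideal.mem_comap, hc i]; exact hmem
  exact not_mem_of_comap_eq (hq i) (hx0 i) (hR i) (hP𝔪 i) (hc i) h1

omit [∀ i, IsLocalRing (R i)] in
/-- In `B = (R 0)_{P 0}`: an element of `R 0` is in `𝔪_B` iff it is in `P 0`, and is a unit of `B` iff it is
not in `P 0` (Mathlib `IsLocalization.AtPrime`). OURS bookkeeping. [folklore] -/
theorem inclusion_mem_maximalIdeal_ofPrime_iff (a : R 0) :
    Subring.inclusion (LocalSubring.le_ofPrime (R 0) (P 0)) a ∈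
        maximalIdeal (LocalSubring.ofPrime (R 0) (P 0)).toSubring ↔ a ∈ P 0 :=
  IsLocalization.AtPrime.to_map_mem_maximal_iff _ (P 0) a

include hq hP𝔪 hc hx0 hR in
/-- **The tower lies in `B = (R 0)_{P 0}` with centre `P i`**: for every `i`, `R i ≤ B` and `𝔪_B ∩ R i = P i`
(so `(R i)_{P i} = B`: one quadratic transform is an isomorphism off the exceptional divisor, and `x_i ∉ P (i+1)`).
Induction on `i`: `x_i` is a unit of `B`; an element `y/w` of `R (i+1)` (`y, w ∈ (R i)[𝔪_i/x_i]`, `v w = 1`) has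
`y, w ∈ B` and `w ∉ 𝔪_B` (else `w·x_i^M ∈ 𝔪_B ∩ R i = P i ⊆ P (i+1)` with `w` a unit of `R (i+1)` and
`x_i ∉ P (i+1)`); the centre is computed with `exists_mul_inclusion_eq`. OURS. [folklore] -/
theorem exists_le_ofPrime_comap_eq : ∀ i, ∃ hle : R i ≤ (LocalSubring.ofPrime (R 0) (P 0)).toSubring,
    (maximalIdeal (LocalSubring.ofPrime (R 0) (P 0)).toSubring).comap (Subring.inclusion hle) = P i := by
  classical
  intro i
  induction i with
  | zero =>
    exact ⟨LocalSubring.le_ofPrime (R 0) (P 0), IsLocalization.AtPrime.under_maximalIdeal _ (P 0)⟩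
  | succ i ih =>
    obtain ⟨hle, hcomap⟩ := ih
    set B := (LocalSubring.ofPrime (R 0) (P 0)).toSubring with hBdef
    have hx0' : ((x i : R i) : K) ≠ 0 := fun e => hx0 i (Subtype.ext e)
    -- `x i` is a unit of `B`
    have hxP : x i ∉ P i := param_not_mem hq hP𝔪 hc hx0 hR i
    have hxunit : IsUnit (Subring.inclusion hle (x i)) := by
      by_contra hnu
      exact hxP (hcomap ▸ Ideal.mem_comap.mpr ((IsLocalRing.mem_maximalIdeal _).mpr hnu))
    have hxinv : ((x i : R i) : K)⁻¹ ∈ B := ((isUnit_subring_iff_inv_mem _).mp hxunit).2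
    -- elements of the blow-up ring lie in `B`
    have hblow : ∀ y, y ∈ blowupRing (R i) ((x i : R i) : K) → y ∈ B := by
      intro y hy
      obtain ⟨N, a, ha⟩ := exists_mul_pow_eq_of_mem_blowupRing hx0' hy
      have hy' : y = (a : K) * (((x i : R i) : K)⁻¹) ^ N := by
        rw [← ha, inv_pow, mul_assoc, mul_inv_cancel₀ (pow_ne_zero _ hx0'), mul_one]
      rw [hy']
      exact B.mul_mem (hle a.2) (B.pow_mem hxinv N)
    -- `R (i+1) ≤ B`
    have hle' : R (i + 1) ≤ B := by
      intro z hz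
      rw [hR i] at hz
      obtain ⟨y, hy, w, hw, hvw, rfl⟩ := mem_locAtCentre_iff.mp hz
      have hyB : y ∈ B := hblow y hy
      have hwB : w ∈ B := hblow w hw
      have hw0 : w ≠ 0 := ne_zero_of_valuation_eq_one hvw
      -- `w ∉ 𝔪_B`
      have hwunit : IsUnit (⟨w, hwB⟩ : B) := by
        by_contra hnu
        have hw𝔪 : (⟨w, hwB⟩ : B) ∈ maximalIdeal B := (IsLocalRing.mem_maximalIdeal _).mpr hnu
        obtain ⟨M, b, hb⟩ := exists_mul_pow_eq_of_mem_blowupRing hx0' hw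
        -- `b = w x^M ∈ 𝔪_B ∩ R i = P i`
        have hbB : Subring.inclusion hle b = ⟨w, hwB⟩ * (Subring.inclusion hle (x i)) ^ M := by
          apply Subtype.ext
          simp only [Subring.coe_mul, Subring.coe_pow, Subring.coe_inclusion]
          exact hb.symm
        have hbP : b ∈ P i := by
          rw [← hcomap, Ideal.mem_comap, hbB]
          exact (maximalIdeal B).mul_mem_right _ hw𝔪
        -- in `R (i+1)`: `b = w' * x^M` with `w'` a unit and `x ∉ P (i+1)`
        have hwR' : w ∈ R (i + 1) := (hR i).symm ▸ le_locAtCentre _ O hw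
        have hwunit' : IsUnit (⟨w, hwR'⟩ : R (i + 1)) := isUnit_of_valuation_eq_one (hq i) hvw
        have hbR' : Subring.inclusion (hq i).le b = ⟨w, hwR'⟩ * (Subring.inclusion (hq i).le (x i)) ^ M := by
          apply Subtype.ext
          simp only [Subring.coe_mul, Subring.coe_pow, Subring.coe_inclusion]
          exact hb.symm
        have hbP' : Subring.inclusion (hq i).le b ∈ P (i + 1) := by rw [← Ideal.mem_comap, hc i]; exact hbP
        rw [hbR'] at hbP'
        rcases Ideal.IsPrime.mem_or_mem inferInstance hbP' with h3 | h3
        · exact Ideal.IsPrime.ne_top inferInstance (Ideal.eq_top_of_isUnit_mem _ h3 hwunit')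
        · exact not_mem_of_comap_eq (hq i) (hx0 i) (hR i) (hP𝔪 i) (hc i) (Ideal.IsPrime.mem_of_pow_mem inferInstance _ h3)
      have hwinv : w⁻¹ ∈ B := ((isUnit_subring_iff_inv_mem _).mp hwunit).2
      rw [div_eq_mul_inv]
      exact B.mul_mem hyB hwinv
    refine ⟨hle', ?_⟩
    -- the centre of `B` on `R (i+1)` is `P (i+1)`
    ext r''
    obtain ⟨s, t, hsP, hst⟩ := exists_mul_inclusion_eq (hq i) (hx0 i) (hR i) (hP𝔪 i) (hc i) r''
    have hstB : Subring.inclusion hle' r'' * Subring.inclusion hle s = Subring.inclusion hle t := by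
      apply Subtype.ext
      have := congrArg (fun w : R (i + 1) => (w : K)) hst
      simpa only [Subring.coe_mul, Subring.coe_inclusion] using this
    have hsunit : IsUnit (Subring.inclusion hle s) := by
      by_contra hnu
      exact hsP (hcomap ▸ Ideal.mem_comap.mpr ((IsLocalRing.mem_maximalIdeal _).mpr hnu))
    have hsP' : Subring.inclusion (hq i).le s ∉ P (i + 1) := fun hmem => by
      rw [← Ideal.mem_comap, hc i] at hmem
      exact hsP hmem
    rw [Ideal.mem_comap]
    constructor
    · intro hr''
      -- `t ∈ 𝔪_B ∩ R i = P i`, so `r''·s ∈ P (i+1)`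
      have htB : Subring.inclusion hle t ∈ maximalIdeal B := by
        rw [← hstB]
        exact (maximalIdeal B).mul_mem_right _ hr''
      have htP : t ∈ P i := hcomap ▸ Ideal.mem_comap.mpr htB
      have h1 : r'' * Subring.inclusion (hq i).le s ∈ P (i + 1) := by
        rw [hst, ← Ideal.mem_comap, hc i]
        exact htP
      rcases Ideal.IsPrime.mem_or_mem inferInstance h1 with h2 | h2
      · exact h2
      · exact absurd h2 hsP'
    · intro hr''
      have htP' : Subring.inclusion (hq i).le t ∈ P (i + 1) := by
        rw [← hst]
        exact (P (i + 1)).mul_mem_right _ hr''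
      have htP : t ∈ P i := by
        rw [← Ideal.mem_comap, hc i] at htP'
        exact htP'
      have htB : Subring.inclusion hle t ∈ maximalIdeal B := by
        have := (hcomap.symm ▸ htP : t ∈ (maximalIdeal B).comap (Subring.inclusion hle))
        exact Ideal.mem_comap.mp this
      rw [← hstB] at htB
      rcases Ideal.IsPrime.mem_or_mem (IsLocalRing.maximalIdeal.isMaximal B).isPrime htB with h2 | h2
      · exact h2
      · exact absurd ((IsLocalRing.mem_maximalIdeal _).mp h2) (not_not.mpr hsunit)

include hq hP𝔪 hc hx0 hR in
/-- `R i ≤ B = (R 0)_{P 0}`. OURS bookkeeping. [folklore] -/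
theorem le_ofPrime (i : ℕ) : R i ≤ (LocalSubring.ofPrime (R 0) (P 0)).toSubring :=
  (exists_le_ofPrime_comap_eq hq hP𝔪 hc hx0 hR i).1

include hP𝔪 hc hx0 hR in
/-- `𝔪_B ∩ R i = P i` for `B = (R 0)_{P 0}`. OURS bookkeeping. [folklore] -/
theorem comap_maximalIdeal_ofPrime (i : ℕ) :
    (maximalIdeal (LocalSubring.ofPrime (R 0) (P 0)).toSubring).comap
      (Subring.inclusion (le_ofPrime hq hP𝔪 hc hx0 hR i)) = P i :=
  (exists_le_ofPrime_comap_eq hq hP𝔪 hc hx0 hR i).2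

include hP𝔪 hc hx0 hR in
/-- Membership form of `𝔪_B ∩ R i = P i`. OURS bookkeeping. [folklore] -/
theorem inclusion_mem_maximalIdeal_iff (i : ℕ) (r : R i) :
    Subring.inclusion (le_ofPrime hq hP𝔪 hc hx0 hR i) r ∈
      maximalIdeal (LocalSubring.ofPrime (R 0) (P 0)).toSubring ↔ r ∈ P i := by
  rw [← Ideal.mem_comap, comap_maximalIdeal_ofPrime hq hP𝔪 hc hx0 hR i]

include hP𝔪 hc hx0 hR in
/-- Elements of `R i ∖ P i` are units of `B = (R 0)_{P 0}`. OURS bookkeeping. [folklore] -/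
theorem isUnit_inclusion_of_not_mem (i : ℕ) {r : R i} (hr : r ∉ P i) :
    IsUnit (Subring.inclusion (le_ofPrime hq hP𝔪 hc hx0 hR i) r) := by
  by_contra hnu
  exact hr ((inclusion_mem_maximalIdeal_iff hq hP𝔪 hc hx0 hR i r).mp ((IsLocalRing.mem_maximalIdeal _).mpr hnu))

omit [∀ i, IsLocalRing (R i)] in
/-- Every element of `B = (R 0)_{P 0}` is a fraction `a/s`, `a ∈ R 0`, `s ∈ R 0 ∖ P 0`. OURS bookkeeping.
[folklore] -/
theorem exists_eq_div_of_mem_ofPrime {z : K} (hz : z ∈ (LocalSubring.ofPrime (R 0) (P 0)).toSubring) :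
    ∃ a s : R 0, s ∉ P 0 ∧ z = (a : K) / (s : K) := by
  obtain ⟨⟨a, s⟩, has⟩ :=
    IsLocalization.surj (P 0).primeCompl (⟨z, hz⟩ : (LocalSubring.ofPrime (R 0) (P 0)).toSubring)
  have hs0 : ((s : R 0) : K) ≠ 0 := by
    intro e
    have : (s : R 0) = 0 := Subtype.ext e
    exact s.2 (this ▸ (P 0).zero_mem)
  refine ⟨a, s, s.2, ?_⟩
  have h1 := congrArg (fun w : (LocalSubring.ofPrime (R 0) (P 0)).toSubring => (w : K)) has
  change z * ((s : R 0) : K) = ((a : R 0) : K) at h1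
  rw [eq_div_iff hs0]
  exact h1

end Tower

end Summit.ResolutionOfSingularities.ResolutionOfSingularities.Theorems.SwitchingDichotomy.CurveEscape

end
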